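import Mathlib.Analysis.Calculus.Deriv.MeanValue
import Mathlib.Analysis.Calculus.ParametricIntegral
import Mathlib.Analysis.SpecialFunctions.Log.Deriv
import Mathlib.Analysis.SpecialFunctions.Exponential
import Mathlib.MeasureTheory.Integral.Bochner.Basic
import HarnessLib

/-!
# Gross's Grönwall step and the weighted moment generating function: the generic letters of a Schwinger–Dyson ⟹ Gaussian-domination argument

Crux of record `UnitScaleTilt.HistoryTailL` (stmt-QuantumFields-19936), cell `ym3-torus` (YM ladder rung R3 = continuum SU(2) Yang–Mills on T³ — a RUNG, NOT the
Clay problem); twin-width seat `ym-ust-19936-w8` gen 9.  Pure real analysis ∕ measure theory (Mathlib only), the «assembly» rows of the crux idea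
«gross-sd-transfer» (LINE 28 candidate, `Cruxes/HistoryTailL/Ideas/gross-sd-transfer.md`, annex 2: stub S_SD), after L. Gross, CMP 92 (1983), proof of Thm 2.2:
once an integration-by-parts identity (tree ✓ `UnitScaleGibbsOneBondSchwingerDyson(Matrix)`) has produced the differential inequality
`ψ′(t) ≤ (a·t + Δ)·ψ(t)` for the weighted Laplace transform `ψ(t) = ∫ e^{tX}·χ dμ` of a flux functional `X`, Gaussian domination and the Chernoff tail follow:

* §1 ★★ `le_mul_exp_of_deriv_le_linear_mul` — GRÖNWALL WITH A LINEAR RATE: `ψ > 0` on `[0, T]`, `ψ′ ≤ (a·t + Δ)·ψ` on `[0, T]` ⟹ `ψ(T) ≤ ψ(0)·exp(aT²∕2 + ΔT)`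
  (`log ψ − (at²∕2 + Δt)` is antitone: Mathlib `antitoneOn_of_deriv_nonpos`).
* §2 ★ `hasDerivAt_integral_exp_mul_weight` — the weighted MGF `t ↦ ∫ exp(t·X)·χ dμ` of a bounded measurable `X` against a bounded measurable weight `χ` under a
  finite measure is differentiable everywhere with derivative `∫ X·exp(t·X)·χ dμ` (dominated differentiation), and is positive when `χ ≥ 0` has positive mass (§2b).
* §3 ★ `measureReal_le_exp_neg_mul_integral_exp_mul_weight` — CHERNOFF WITH A WEIGHT: for `t ≥ 0` and `χ ≥ 0` with `χ = 1` on the event,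
  `μ{θ ≤ X} ∩ {χ = 1} ≤ e^{−tθ}·∫ e^{tX}·χ dμ`; ★★ `measureReal_le_of_gronwall` — the two combined: the sub-Gaussian tail `ψ(0)·exp(−tθ + at²∕2 + Δt)`.

THEOREMS ONLY (0 `def`, 0 `sorry`); `--supports stmt-QuantumFields-19936 --as helper`.  HONEST SCOPE: generic letters; the differential inequality itself (the
content of S_SD ∕ S_dom) is a HYPOTHESIS here; nothing of (Q), «BlockSecondMomentL», K1, `MeanDeviationL`, `HistoryTailL`, R3, d = 4, a continuum limit or a mass gap is
proved; the Yang–Mills mass gap is NOT proved.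

References: L. Gross, Convergence of U(1)₃ lattice gauge theory to its continuum limit, CMP 92 (1983) 137–162, Thm 2.2 and its proof (the Grönwall inequality
`φ′ ≤ (αt‖φ‖²∕β)φ`) [GrossCMP1983]; S. Boucheron, G. Lugosi, P. Massart, Concentration Inequalities (2013), §2.2 (Cramér–Chernoff) [BoucheronLugosiMassart2013].
-/

noncomputable section

open MeasureTheory Set Filter Topology

namespace Summit.QuantumFields.YangMills.Theorems.UnitScaleGibbsMGFGronwall

/-! ## §1 Grönwall with a linear rate -/

/-- ★★ **GRÖNWALL WITH A LINEAR RATE** (Gross's closing step): if `ψ` is differentiable on `[0, T]` with `ψ > 0` and `ψ′(t) ≤ (a·t + Δ)·ψ(t)` there, then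
`ψ(T) ≤ ψ(0)·exp(a·T²∕2 + Δ·T)`.  Proof: `h(t) = log ψ(t) − (a t²∕2 + Δ t)` has `h′ ≤ 0`, hence is antitone on `[0, T]`. [cite: GrossCMP1983, Thm 2.2 (proof)] -/
theorem le_mul_exp_of_deriv_le_linear_mul {ψ ψ' : ℝ → ℝ} {a Δ T : ℝ} (hT : 0 ≤ T)
    (hψ : ∀ t ∈ Icc (0 : ℝ) T, HasDerivAt ψ (ψ' t) t) (hpos : ∀ t ∈ Icc (0 : ℝ) T, 0 < ψ t)
    (hineq : ∀ t ∈ Icc (0 : ℝ) T, ψ' t ≤ (a * t + Δ) * ψ t) :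
    ψ T ≤ ψ 0 * Real.exp (a * T ^ 2 / 2 + Δ * T) := by
  -- the comparison function (with `t * t` for the derivative bookkeeping)
  set h : ℝ → ℝ := fun t => Real.log (ψ t) - (a * (t * t) / 2 + Δ * t) with hh
  have hderiv : ∀ t ∈ Icc (0 : ℝ) T, HasDerivAt h (ψ' t / ψ t - (a * t + Δ)) t := by
    intro t ht
    have h1 : HasDerivAt (fun s => Real.log (ψ s)) (ψ' t / ψ t) t := (hψ t ht).log (hpos t ht).ne'
    have h2 : HasDerivAt (fun s : ℝ => a * (s * s) / 2 + Δ * s) (a * (1 * t + t * 1) / 2 + Δ * 1) t :=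
      ((((hasDerivAt_id' t).mul (hasDerivAt_id' t)).const_mul a).div_const 2).add ((hasDerivAt_id' t).const_mul Δ)
    exact (h1.sub h2).congr_deriv (by ring)
  have hanti : AntitoneOn h (Icc (0 : ℝ) T) := by
    refine antitoneOn_of_deriv_nonpos (convex_Icc 0 T) ?_ ?_ ?_
    · exact fun t ht => (hderiv t ht).continuousAt.continuousWithinAt
    · intro t ht
      exact (hderiv t (interior_subset ht)).differentiableAt.differentiableWithinAt
    · intro t ht
      have ht' : t ∈ Icc (0 : ℝ) T := interior_subset ht
      rw [(hderiv t ht').deriv]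
      have hq : ψ' t / ψ t ≤ a * t + Δ := by
        rw [div_le_iff₀ (hpos t ht')]
        exact hineq t ht'
      linarith
  have h0T : h T ≤ h 0 := hanti (left_mem_Icc.2 hT) (right_mem_Icc.2 hT) hT
  have hψT := hpos T (right_mem_Icc.2 hT)
  have hψ0 := hpos 0 (left_mem_Icc.2 hT)
  -- unwind the logarithms
  have hlog : Real.log (ψ T) ≤ Real.log (ψ 0) + (a * T ^ 2 / 2 + Δ * T) := by
    have h' : Real.log (ψ T) - (a * (T * T) / 2 + Δ * T) ≤ Real.log (ψ 0) - (a * (0 * 0) / 2 + Δ * 0) := h0T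
    rw [sq]
    linarith
  calc ψ T = Real.exp (Real.log (ψ T)) := (Real.exp_log hψT).symm
    _ ≤ Real.exp (Real.log (ψ 0) + (a * T ^ 2 / 2 + Δ * T)) := Real.exp_le_exp.2 hlog
    _ = ψ 0 * Real.exp (a * T ^ 2 / 2 + Δ * T) := by rw [Real.exp_add, Real.exp_log hψ0]

/-- The same with the conclusion at every intermediate time `s ∈ [0, T]`. [cite: GrossCMP1983, Thm 2.2 (proof)] -/
theorem le_mul_exp_of_deriv_le_linear_mul_of_mem {ψ ψ' : ℝ → ℝ} {a Δ T : ℝ}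
    (hψ : ∀ t ∈ Icc (0 : ℝ) T, HasDerivAt ψ (ψ' t) t) (hpos : ∀ t ∈ Icc (0 : ℝ) T, 0 < ψ t)
    (hineq : ∀ t ∈ Icc (0 : ℝ) T, ψ' t ≤ (a * t + Δ) * ψ t) {s : ℝ} (hs : s ∈ Icc (0 : ℝ) T) :
    ψ s ≤ ψ 0 * Real.exp (a * s ^ 2 / 2 + Δ * s) :=
  le_mul_exp_of_deriv_le_linear_mul hs.1 (fun t ht => hψ t ⟨ht.1, ht.2.trans hs.2⟩)
    (fun t ht => hpos t ⟨ht.1, ht.2.trans hs.2⟩) (fun t ht => hineq t ⟨ht.1, ht.2.trans hs.2⟩)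

/-! ## §2 The weighted moment generating function of a bounded observable -/

section MGF

variable {Ω : Type*} [MeasurableSpace Ω] (μ : Measure Ω) [IsFiniteMeasure μ]

/-- ★ **DERIVATIVE OF THE WEIGHTED MGF.**  For bounded measurable `X` (`|X| ≤ B`) and a bounded measurable weight `χ` (`|χ| ≤ M`) under a finite measure,
`t ↦ ∫ exp(t·X)·χ dμ` has derivative `∫ X·exp(t·X)·χ dμ` at every `t` (dominated differentiation on `(t − 1, t + 1)` with majorant `B·e^{(|t|+1)B}·M`).
[cite: BoucheronLugosiMassart2013, §2.2] -/
theorem hasDerivAt_integral_exp_mul_weight {X χ : Ω → ℝ} (hXm : Measurable X) (hχm : Measurable χ) {B M : ℝ}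
    (hXB : ∀ ω, |X ω| ≤ B) (hχM : ∀ ω, |χ ω| ≤ M) (t : ℝ) :
    HasDerivAt (fun s : ℝ => ∫ ω, Real.exp (s * X ω) * χ ω ∂μ) (∫ ω, X ω * Real.exp (t * X ω) * χ ω ∂μ) t := by
  -- non-negative majorants (valid also on an empty `Ω`)
  set B' : ℝ := max B 0 with hB'
  set M' : ℝ := max M 0 with hM'
  have hXB' : ∀ ω, |X ω| ≤ B' := fun ω => (hXB ω).trans (le_max_left _ _)
  have hχM' : ∀ ω, |χ ω| ≤ M' := fun ω => (hχM ω).trans (le_max_left _ _)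
  have hB0 : 0 ≤ B' := le_max_right _ _
  have hM0 : 0 ≤ M' := le_max_right _ _
  -- uniform bounds on the ball `(t - 1, t + 1)`
  set K : ℝ := (|t| + 1) * B' with hK
  have hexpK : ∀ s ∈ Metric.ball t 1, ∀ ω, s * X ω ≤ K := by
    intro s hs ω
    have hs' : |s| ≤ |t| + 1 := by
      have h1 : |s - t| < 1 := by simpa [Real.dist_eq] using hs
      have h2 : |s| ≤ |t| + |s - t| := by
        calc |s| = |t + (s - t)| := by ring_nf
          _ ≤ |t| + |s - t| := abs_add_le _ _
      linarith
    calc s * X ω ≤ |s * X ω| := le_abs_self _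
      _ = |s| * |X ω| := abs_mul _ _
      _ ≤ (|t| + 1) * B' := mul_le_mul hs' (hXB' ω) (abs_nonneg _) (by positivity)
  have hmeasF : ∀ s, AEStronglyMeasurable (fun ω => Real.exp (s * X ω) * χ ω) μ := fun s =>
    (((measurable_const.mul hXm).exp).mul hχm).aestronglyMeasurable
  have hmeasF' : ∀ s, AEStronglyMeasurable (fun ω => X ω * Real.exp (s * X ω) * χ ω) μ := fun s =>
    (((hXm.mul (measurable_const.mul hXm).exp)).mul hχm).aestronglyMeasurable
  have hint : Integrable (fun ω => Real.exp (t * X ω) * χ ω) μ := by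
    refine (integrable_const (Real.exp K * M')).mono' (hmeasF t) (Eventually.of_forall fun ω => ?_)
    rw [Real.norm_eq_abs, abs_mul, abs_of_pos (Real.exp_pos _)]
    exact mul_le_mul (Real.exp_le_exp.2 (hexpK t (Metric.mem_ball_self one_pos) ω)) (hχM' ω) (abs_nonneg _)
      (Real.exp_pos _).le
  have hbd : ∀ᵐ ω ∂μ, ∀ s ∈ Metric.ball t 1, ‖X ω * Real.exp (s * X ω) * χ ω‖ ≤ B' * Real.exp K * M' := by
    refine Eventually.of_forall fun ω s hs => ?_
    rw [Real.norm_eq_abs, abs_mul, abs_mul, abs_of_pos (Real.exp_pos _)]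
    have h1 : |X ω| * Real.exp (s * X ω) ≤ B' * Real.exp K :=
      mul_le_mul (hXB' ω) (Real.exp_le_exp.2 (hexpK s hs ω)) (Real.exp_pos _).le hB0
    exact mul_le_mul h1 (hχM' ω) (abs_nonneg _) (by positivity)
  have hdiff : ∀ᵐ ω ∂μ, ∀ s ∈ Metric.ball t 1,
      HasDerivAt (fun s : ℝ => Real.exp (s * X ω) * χ ω) (X ω * Real.exp (s * X ω) * χ ω) s := by
    refine Eventually.of_forall fun ω s _ => ?_
    have h1 : HasDerivAt (fun s : ℝ => s * X ω) (1 * X ω) s := (hasDerivAt_id' s).mul_const (X ω)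
    exact ((h1.exp).mul_const (χ ω)).congr_deriv (by ring)
  exact (hasDerivAt_integral_of_dominated_loc_of_deriv_le (Metric.ball_mem_nhds t one_pos)
    (Eventually.of_forall hmeasF) hint (hmeasF' t) hbd (integrable_const _) hdiff).2

/-- **POSITIVITY OF THE WEIGHTED MGF** for a non-negative weight of positive mass. [cite: BoucheronLugosiMassart2013, §2.2] -/
theorem integral_exp_mul_weight_pos {X χ : Ω → ℝ} (hXm : Measurable X) (hχm : Measurable χ) {B M : ℝ}
    (hXB : ∀ ω, |X ω| ≤ B) (hχM : ∀ ω, |χ ω| ≤ M) (hχ0 : ∀ ω, 0 ≤ χ ω) (hmass : 0 < ∫ ω, χ ω ∂μ) (t : ℝ) :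
    0 < ∫ ω, Real.exp (t * X ω) * χ ω ∂μ := by
  -- lower bound `e^{-|t|B}·χ ≤ e^{tX}·χ`
  have hlow : ∀ ω, Real.exp (-(|t| * B)) * χ ω ≤ Real.exp (t * X ω) * χ ω := fun ω => by
    refine mul_le_mul_of_nonneg_right (Real.exp_le_exp.2 ?_) (hχ0 ω)
    have : |t * X ω| ≤ |t| * B := by rw [abs_mul]; exact mul_le_mul_of_nonneg_left (hXB ω) (abs_nonneg _)
    linarith [neg_abs_le (t * X ω)]
  have hintχ : Integrable χ μ := (integrable_const M).mono' hχm.aestronglyMeasurable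
    (Eventually.of_forall fun ω => by rw [Real.norm_eq_abs]; exact hχM ω)
  have hint : Integrable (fun ω => Real.exp (t * X ω) * χ ω) μ := by
    refine (integrable_const (Real.exp (|t| * B) * M)).mono' ((((measurable_const.mul hXm).exp).mul hχm).aestronglyMeasurable)
      (Eventually.of_forall fun ω => ?_)
    rw [Real.norm_eq_abs, abs_mul, abs_of_pos (Real.exp_pos _)]
    refine mul_le_mul (Real.exp_le_exp.2 ?_) (hχM ω) (abs_nonneg _) (Real.exp_pos _).le
    have : |t * X ω| ≤ |t| * B := by rw [abs_mul]; exact mul_le_mul_of_nonneg_left (hXB ω) (abs_nonneg _)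
    linarith [le_abs_self (t * X ω)]
  calc (0 : ℝ) < Real.exp (-(|t| * B)) * ∫ ω, χ ω ∂μ := mul_pos (Real.exp_pos _) hmass
    _ = ∫ ω, Real.exp (-(|t| * B)) * χ ω ∂μ := (integral_const_mul _ _).symm
    _ ≤ ∫ ω, Real.exp (t * X ω) * χ ω ∂μ := integral_mono (hintχ.const_mul _) hint hlow

/-! ## §3 Chernoff with a weight, and the assembled sub-Gaussian tail -/

/-- ★ **CHERNOFF WITH A WEIGHT**: for `t ≥ 0`, a weight `χ ≥ 0` and the event `E = {θ ≤ X} ∩ {χ = 1}` (e.g. `χ` a cut-off equal to `1` on a good event),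
`μ.real E ≤ e^{−tθ}·∫ e^{tX}·χ dμ`. [cite: BoucheronLugosiMassart2013, §2.2] -/
theorem measureReal_le_exp_neg_mul_integral_exp_mul_weight {X χ : Ω → ℝ} (hXm : Measurable X) (hχm : Measurable χ) {B M : ℝ}
    (hXB : ∀ ω, |X ω| ≤ B) (hχM : ∀ ω, |χ ω| ≤ M) (hχ0 : ∀ ω, 0 ≤ χ ω) {t : ℝ} (ht : 0 ≤ t) (θ : ℝ) :
    μ.real {ω | θ ≤ X ω ∧ χ ω = 1} ≤ Real.exp (-(t * θ)) * ∫ ω, Real.exp (t * X ω) * χ ω ∂μ := by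
  set E : Set Ω := {ω | θ ≤ X ω ∧ χ ω = 1} with hE
  have hEm : MeasurableSet E := (measurableSet_le measurable_const hXm).inter (hχm (measurableSet_singleton 1))
  have hint : Integrable (fun ω => Real.exp (t * X ω) * χ ω) μ := by
    refine (integrable_const (Real.exp (|t| * B) * M)).mono' ((((measurable_const.mul hXm).exp).mul hχm).aestronglyMeasurable)
      (Eventually.of_forall fun ω => ?_)
    rw [Real.norm_eq_abs, abs_mul, abs_of_pos (Real.exp_pos _)]
    refine mul_le_mul (Real.exp_le_exp.2 ?_) (hχM ω) (abs_nonneg _) (Real.exp_pos _).le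
    have : |t * X ω| ≤ |t| * B := by rw [abs_mul]; exact mul_le_mul_of_nonneg_left (hXB ω) (abs_nonneg _)
    linarith [le_abs_self (t * X ω)]
  -- pointwise: `e^{tθ}·1_E ≤ e^{tX}·χ`
  have hpt : ∀ ω, Real.exp (t * θ) * E.indicator (fun _ => (1 : ℝ)) ω ≤ Real.exp (t * X ω) * χ ω := by
    intro ω
    by_cases hω : ω ∈ E
    · rw [indicator_of_mem hω, mul_one]
      obtain ⟨h1, h2⟩ := hω
      rw [h2, mul_one]
      exact Real.exp_le_exp.2 (mul_le_mul_of_nonneg_left h1 ht)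
    · rw [indicator_of_notMem hω, mul_zero]
      exact mul_nonneg (Real.exp_pos _).le (hχ0 ω)
  have hI : ∫ ω, Real.exp (t * θ) * E.indicator (fun _ => (1 : ℝ)) ω ∂μ = Real.exp (t * θ) * μ.real E := by
    rw [integral_const_mul, integral_indicator_const (1 : ℝ) hEm, smul_eq_mul, mul_one]
  have hle : Real.exp (t * θ) * μ.real E ≤ ∫ ω, Real.exp (t * X ω) * χ ω ∂μ := by
    rw [← hI]
    exact integral_mono ((integrable_const _).indicator hEm |>.const_mul _) hint hpt
  calc μ.real E = Real.exp (-(t * θ)) * (Real.exp (t * θ) * μ.real E) := by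
        rw [← mul_assoc, ← Real.exp_add, neg_add_cancel, Real.exp_zero, one_mul]
    _ ≤ Real.exp (-(t * θ)) * ∫ ω, Real.exp (t * X ω) * χ ω ∂μ := mul_le_mul_of_nonneg_left hle (Real.exp_pos _).le

/-- ★★ **THE ASSEMBLED SUB-GAUSSIAN TAIL.**  If the weighted Laplace transform `ψ(s) = ∫ e^{sX}·χ dμ` (bounded measurable `X`, weight `0 ≤ χ ≤ M` of positive mass)
obeys the Schwinger–Dyson ∕ Grönwall differential inequality `ψ′(s) ≤ (a·s + Δ)·ψ(s)` on `[0, t]`, then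
`μ{θ ≤ X, χ = 1} ≤ ψ(0)·exp(−tθ + a·t²∕2 + Δ·t)` — Gross's Thm 2.2 mechanism with a defect rate `Δ` and a cut-off `χ`. [cite: GrossCMP1983, Thm 2.2 (proof)] -/
theorem measureReal_le_of_gronwall {X χ : Ω → ℝ} (hXm : Measurable X) (hχm : Measurable χ) {B M : ℝ}
    (hXB : ∀ ω, |X ω| ≤ B) (hχM : ∀ ω, |χ ω| ≤ M) (hχ0 : ∀ ω, 0 ≤ χ ω) (hmass : 0 < ∫ ω, χ ω ∂μ)
    {a Δ t : ℝ} (ht : 0 ≤ t)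
    (hineq : ∀ s ∈ Icc (0 : ℝ) t,
      ∫ ω, X ω * Real.exp (s * X ω) * χ ω ∂μ ≤ (a * s + Δ) * ∫ ω, Real.exp (s * X ω) * χ ω ∂μ) (θ : ℝ) :
    μ.real {ω | θ ≤ X ω ∧ χ ω = 1} ≤
      (∫ ω, χ ω ∂μ) * Real.exp (-(t * θ) + (a * t ^ 2 / 2 + Δ * t)) := by
  have hgron := le_mul_exp_of_deriv_le_linear_mul (ψ := fun s => ∫ ω, Real.exp (s * X ω) * χ ω ∂μ)
    (ψ' := fun s => ∫ ω, X ω * Real.exp (s * X ω) * χ ω ∂μ) (a := a) (Δ := Δ) ht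
    (fun s _ => hasDerivAt_integral_exp_mul_weight μ hXm hχm hXB hχM s)
    (fun s _ => integral_exp_mul_weight_pos μ hXm hχm hXB hχM hχ0 hmass s) hineq
  have hcher := measureReal_le_exp_neg_mul_integral_exp_mul_weight μ hXm hχm hXB hχM hχ0 ht θ
  calc μ.real {ω | θ ≤ X ω ∧ χ ω = 1} ≤ Real.exp (-(t * θ)) * ∫ ω, Real.exp (t * X ω) * χ ω ∂μ := hcher
    _ ≤ Real.exp (-(t * θ)) * ((∫ ω, χ ω ∂μ) * Real.exp (a * t ^ 2 / 2 + Δ * t)) := by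
        refine mul_le_mul_of_nonneg_left ?_ (Real.exp_pos _).le
        have hg := hgron
        simp only [zero_mul, Real.exp_zero, one_mul] at hg
        exact hg
    _ = (∫ ω, χ ω ∂μ) * Real.exp (-(t * θ) + (a * t ^ 2 / 2 + Δ * t)) := by simp only [Real.exp_add]; ring

end MGF

end Summit.QuantumFields.YangMills.Theorems.UnitScaleGibbsMGFGronwall

end
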